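import Summits.ResolutionOfSingularities.ResolutionOfSingularities.Theorems.WildDescent4
import HarnessLib

/-!
# WildDescent (5/13) — β-descent in a linear frame; §5 WallChart (L3a): `wall_step`, exact point laws `pts_chartTransform_snd/fst`

Verbatim slice of the farm-checked monolith `WildDescent.lean` of cell `decomp-res`, seat `decomp-res-lens-5`, g36
(sha256 4ec0fa6f4f9efba7…); one namespace `Summit.ResolutionOfSingularities.ResolutionOfSingularities.Theorems.WildDescent` across the
slices, imports chained (laws L1–L7 and the mechanism: module docstring of slice 1; main theorems: slice 13/13).
-/

open MvPolynomial Finset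
open scoped BigOperators
open Literature.AlgebraicGeometry.Resolution
open Literature.AlgebraicGeometry.Resolution.Hauser2010
open Literature.AlgebraicGeometry.Resolution.PointBlowup
open Literature.AlgebraicGeometry.Resolution.HauserPerlega2024

namespace Summit.ResolutionOfSingularities.ResolutionOfSingularities.Theorems.WildDescent

/-! ## §5 THE WALL-CHART MOVE (L3a: transport law of the frame, nearness, exact point law `Δ' = T(Δ)`) -/

section WallChart

variable {K : Type} [Field K]

/-- A polynomial all of whose monomials are divisible by `y_l` lies in `(y_l)`. [folklore] -/
theorem mem_span_X_of_forall_coeff {σ : Type*} {l : σ} {P : MvPolynomial σ K}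
    (h : ∀ D : σ →₀ ℕ, D l = 0 → coeff D P = 0) : P ∈ Ideal.span {(X l : MvPolynomial σ K)} := by
  classical
  rw [P.as_sum]
  refine Ideal.sum_mem _ fun D hD => ?_
  have hDl : D l ≠ 0 := fun h0 => (mem_support_iff.mp hD) (h D h0)
  have hexp : Finsupp.single l 1 + (D - Finsupp.single l 1) = D := by
    ext i
    simp only [Finsupp.add_apply, Finsupp.tsub_apply, Finsupp.single_apply]
    split_ifs with h
    · subst h; omega
    · omega
  have hdec : monomial D (coeff D P) = X l * monomial (D - Finsupp.single l 1) (coeff D P) := by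
    rw [← pow_one (X l), X_pow_eq_monomial, monomial_mul, one_mul, hexp]
  rw [hdec]
  exact Ideal.mul_mem_right _ _ (Ideal.subset_span rfl)

/-- `chartTransform 1 l` of the linear form `a y_k + b y_l` is `a y_k + b`. [cite: Hauser2010, §F] -/
theorem chartTransform_one_lin {k l : Fin 3} (hkl : k ≠ l) (a b : K) :
    chartTransform 1 l (C a * X k + C b * X l : MvPolynomial (Fin 3) K) = C a * X k + C b := by
  rw [HauserPerlega2024.chartTransform_add, C_mul_X_eq_monomial, C_mul_X_eq_monomial,
    HauserPerlega2024.chartTransform_monomial, HauserPerlega2024.chartTransform_monomial]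
  have h1 : chartExponent 1 l (Finsupp.single k 1) = Finsupp.single k 1 := by
    ext i
    rw [PointBlowup.chartExponent_apply]
    split_ifs with h
    · subst h; rw [Finsupp.degree_single, Finsupp.single_apply, if_neg hkl, Nat.sub_self]
    · rfl
  have h2 : chartExponent 1 l (Finsupp.single l 1) = 0 := by
    ext i
    rw [PointBlowup.chartExponent_apply, Finsupp.zero_apply]
    split_ifs with h
    · rw [Finsupp.degree_single, Nat.sub_self]
    · rw [Finsupp.single_apply, if_neg (Ne.symm h)]
  rw [h1, h2, ← C_mul_X_eq_monomial, ← C_apply]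

/-- The chart transform of a frame polynomial is `≡ c·y_f^s (mod y_l)`: its only monomial prime to `y_l` is `y_f^s`.
[cite: CossartJannsenSaito2020, Lemma 8.5 p.110] -/
theorem chartTransform_sub_mem_span {f l : Fin 3} (hfl : f ≠ l) {s : ℕ}
    {H : MvPolynomial (Fin 3) K} {c : K} (hin : homogeneousComponent s H = C c * X f ^ s)
    (hord : (s : ℕ∞) ≤ ordZero H) :
    chartTransform s l H - C c * X f ^ s ∈ Ideal.span {(X l : MvPolynomial (Fin 3) K)} := by
  classical
  have hsupp : ∀ d ∈ H.support, s ≤ d.degree := fun d hd => le_degree_of_mem_support hord hd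
  have hχ : chartExponent s l (Finsupp.single f s) = Finsupp.single f s := by
    ext i
    rw [PointBlowup.chartExponent_apply]
    split_ifs with h
    · subst h; rw [Finsupp.degree_single, Finsupp.single_apply, if_neg hfl, Nat.sub_self]
    · rfl
  refine mem_span_X_of_forall_coeff fun D hDl => ?_
  rw [coeff_sub, X_pow_eq_monomial, coeff_C_mul, coeff_monomial]
  by_cases hD : Finsupp.single f s = D
  · rw [if_pos hD, mul_one, ← hD, ← hχ]
    by_cases hmem : Finsupp.single f s ∈ H.support
    · rw [HauserPerlega2024.coeff_chartExponent_chartTransform s l hsupp hmem]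
      have h2 : coeff (Finsupp.single f s) (homogeneousComponent s H) = coeff (Finsupp.single f s) H := by
        rw [coeff_homogeneousComponent, if_pos (Finsupp.degree_single f s)]
      rw [← h2, hin, X_pow_eq_monomial, coeff_C_mul, coeff_monomial, if_pos rfl, mul_one, sub_self]
    · -- then `c = 0` and the transform has no such monomial either
      have hc : c = 0 := by
        have h2 : coeff (Finsupp.single f s) (homogeneousComponent s H) = coeff (Finsupp.single f s) H := by
          rw [coeff_homogeneousComponent, if_pos (Finsupp.degree_single f s)]
        have h3 := notMem_support_iff.mp hmem
        rw [← h2, hin, X_pow_eq_monomial, coeff_C_mul, coeff_monomial, if_pos rfl, mul_one] at h3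
        exact h3
      rw [hc, sub_zero, hχ, ← notMem_support_iff, HauserPerlega2024.support_chartTransform s l hsupp, Finset.mem_image]
      rintro ⟨d, hd, hdD⟩
      rw [← hχ] at hdD
      have := PointBlowup.chartExponent_injective (hsupp d hd) (by rw [Finsupp.degree_single]) hdD
      rw [this] at hd
      exact hmem hd
  · rw [if_neg hD, mul_zero, sub_zero, ← notMem_support_iff, HauserPerlega2024.support_chartTransform s l hsupp,
      Finset.mem_image]
    rintro ⟨d, hd, hdD⟩
    have hdeg : d.degree = s := by
      have := DFunLike.congr_fun hdD l
      rw [PointBlowup.chartExponent_apply, if_pos rfl, hDl] at this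
      have := hsupp d hd
      omega
    have hds := eq_single_of_degree_eq hin hd hdeg
    rw [hds, hχ] at hdD
    exact hD hdD

/-- The constant coefficient of `σ(c·y_f^s)` for the affine shear `y_f ↦ y_f + a y_k + κ₁` is `c κ₁^s`. [folklore] -/
theorem constantCoeff_zshear_C_mul_X_pow {f k : Fin 3} (a κ₁ c : K) (s : ℕ) :
    constantCoeff (WallFrames.zshear f (C a * X k + C κ₁) (C c * X f ^ s)) = c * κ₁ ^ s := by
  rw [zshear_C_mul_pow, WallFrames.zshear_X_self, map_mul, constantCoeff_C, map_pow, map_add, map_add, constantCoeff_X,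
    map_mul, constantCoeff_C, constantCoeff_X, constantCoeff_C, mul_zero, zero_add, zero_add]

/-- The shear along `y_f` preserves the ideal `(y_l)`, `l ≠ f`. [folklore] -/
theorem zshear_mem_span_X {σ : Type*} [DecidableEq σ] {f l : σ} (hlf : l ≠ f) (ζ : MvPolynomial σ K) {P : MvPolynomial σ K}
    (hP : P ∈ Ideal.span {(X l : MvPolynomial σ K)}) : WallFrames.zshear f ζ P ∈ Ideal.span {(X l : MvPolynomial σ K)} := by
  obtain ⟨R, rfl⟩ := Ideal.mem_span_singleton'.mp hP
  rw [map_mul, WallFrames.zshear_X_of_ne hlf]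
  exact Ideal.mem_span_singleton'.mpr ⟨_, rfl⟩

/-- **WALL-CHART LAW (L3a + nearness).**  Frame `G = σ_η(H)`, `η = a_k y_k + a_l y_l`; the move blows up the origin, takes the
chart of the LOST wall `y_l` and translates by `b = b_f e_f`; if the new stage is near (`ord ≥ 1` suffices) then
(i) NEARNESS `a_l + b_f = 0` (the centre lies on the tangent plane) and (ii) the TRANSPORTED FRAME
`σ_{−a_k y_k}(G') = chartTransform s l H` — the new frame polynomial is the bare chart transform of the old one.
[cite: CossartJannsenSaito2020, Lemmas 11.1/11.2 p.129; Kollar2007, 2.59.1] -/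
theorem wall_step {f k l : Fin 3} (hfk : f ≠ k) (hfl : f ≠ l) (hkl : k ≠ l) {s : ℕ} (hs : s ≠ 0)
    {H : MvPolynomial (Fin 3) K} {c ak al : K} (hc : c ≠ 0) (hin : homogeneousComponent s H = C c * X f ^ s)
    (hord : ordZero H = s) {b : Fin 3 → K} (hb : ∀ i, i ≠ f → b i = 0)
    (hnear : (1 : ℕ∞) ≤ ordZero (PointBlowup.translate b (chartTransform s l (WallFrames.zshear f (C ak * X k + C al * X l) H)))) :
    al + b f = 0 ∧
      WallFrames.zshear f (-(C ak * X k)) (PointBlowup.translate b (chartTransform s l (WallFrames.zshear f (C ak * X k + C al * X l) H))) =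
        chartTransform s l H := by
  have hηf := varFree_lin (K := K) (Ne.symm hfk) (Ne.symm hfl) ak al
  have hnegη : (-(C ak * X k + C al * X l) : MvPolynomial (Fin 3) K) = C (-ak) * X k + C (-al) * X l := by
    rw [map_neg, map_neg]; ring
  have hηf' : ∀ μ ∈ (-(C ak * X k + C al * X l) : MvPolynomial (Fin 3) K).support, μ f = 0 := by
    rw [hnegη]; exact varFree_lin (Ne.symm hfk) (Ne.symm hfl) (-ak) (-al)
  have hη1 : (1 : ℕ∞) ≤ ordZero (-(C ak * X k + C al * X l) : MvPolynomial (Fin 3) K) := by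
    rw [ordZero_neg]; exact one_le_ordZero_lin k l ak al
  have hordG : (s : ℕ∞) ≤ ordZero (WallFrames.zshear f (C ak * X k + C al * X l) H) := by
    rw [WallFrames.ordZero_zshear hηf (one_le_ordZero_lin k l ak al), hord]
  have hT := WallFrames.transport_law (Ne.symm hfl) hη1 hb hordG
  rw [WallFrames.zshear_neg_zshear hηf, hnegη, chartTransform_one_lin hkl] at hT
  -- `hT : zshear f (C (-ak) * X k + C (-al) - C (b f)) G' = chartTransform s l H`
  set G' := PointBlowup.translate b (chartTransform s l (WallFrames.zshear f (C ak * X k + C al * X l) H)) with hG'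
  have hζ'f : ∀ μ ∈ (C (-ak) * X k + C (-al) - C (b f) : MvPolynomial (Fin 3) K).support, μ f = 0 :=
    WallFrames.varFree_sub (WallFrames.varFree_add (WallFrames.varFree_mul (WallFrames.varFree_C f _)
      (WallFrames.varFree_X_of_ne (Ne.symm hfk))) (WallFrames.varFree_C f _)) (WallFrames.varFree_C f _)
  have hback : G' = WallFrames.zshear f (-(C (-ak) * X k + C (-al) - C (b f))) (chartTransform s l H) := by
    rw [← hT, WallFrames.zshear_neg_zshear hζ'f]
  have hneg' : (-(C (-ak) * X k + C (-al) - C (b f)) : MvPolynomial (Fin 3) K) = C ak * X k + C (al + b f) := by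
    rw [map_neg, map_neg, map_add]; ring
  rw [hneg'] at hback
  -- nearness: constant coefficients
  have hκ : al + b f = 0 := by
    have h0 : constantCoeff G' = 0 := (one_le_ordZero_iff G').mp hnear
    have hmem := zshear_mem_span_X (Ne.symm hfl) (C ak * X k + C (al + b f))
      (chartTransform_sub_mem_span hfl hin hord.symm.le)
    rw [map_sub, ← hback] at hmem
    have h1 := constantCoeff_eq_of_sub_mem_span_X hmem
    rw [h0, constantCoeff_zshear_C_mul_X_pow] at h1
    have h2 : (al + b f) ^ s = 0 := by
      rcases mul_eq_zero.mp h1.symm with h | h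
      · exact absurd h hc
      · exact h
    exact pow_eq_zero_iff hs |>.mp h2
  refine ⟨hκ, ?_⟩
  rw [← hT]
  congr 1
  have hbf : b f = -al := by
    have := hκ; rw [add_comm] at this; exact eq_neg_of_add_eq_zero_left this
  rw [hbf, map_neg, map_neg]; congr 1; ring

/-- **EXACT POINT LAW, slot 2 lost:** `Δ(chartTransform s v H) = Φ(Δ(H))`.
[cite: CossartJannsenSaito2020, Lemma 11.2 p.129] -/
theorem pts_chartTransform_snd {f u v : Fin 3} (hfu : f ≠ u) (hfv : f ≠ v) (huv : u ≠ v) {s : ℕ}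
    {H : MvPolynomial (Fin 3) K} (hord : (s : ℕ∞) ≤ ordZero H) :
    pts s f u v (chartTransform s v H) = (pts s f u v H).image phi := by
  classical
  have hsupp : ∀ d ∈ H.support, s ≤ d.degree := fun d hd => le_degree_of_mem_support hord hd
  have hσ := fin3_exhaust hfu hfv huv
  ext x
  rw [mem_pts, Finset.mem_image]
  constructor
  · rintro ⟨D, hD, hDf, rfl⟩
    rw [HauserPerlega2024.support_chartTransform s v hsupp, Finset.mem_image] at hD
    obtain ⟨d, hd, rfl⟩ := hD
    rw [PointBlowup.chartExponent_apply, if_neg hfv] at hDf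
    exact ⟨pt s f u v d, pt_mem_pts hd hDf, (pt_chartExponent_snd hfu hfv huv hσ (hsupp d hd) hDf).symm⟩
  · rintro ⟨y, hy, rfl⟩
    obtain ⟨d, hd, hdf, rfl⟩ := mem_pts.mp hy
    refine ⟨chartExponent s v d, ?_, ?_, pt_chartExponent_snd hfu hfv huv hσ (hsupp d hd) hdf⟩
    · rw [HauserPerlega2024.support_chartTransform s v hsupp]; exact Finset.mem_image_of_mem _ hd
    · rw [PointBlowup.chartExponent_apply, if_neg hfv]; exact hdf

/-- **EXACT POINT LAW, slot 1 lost:** `Δ(chartTransform s u H) = Ψ(Δ(H))`.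
[cite: CossartJannsenSaito2020, Lemma 11.1 p.129] -/
theorem pts_chartTransform_fst {f u v : Fin 3} (hfu : f ≠ u) (hfv : f ≠ v) (huv : u ≠ v) {s : ℕ}
    {H : MvPolynomial (Fin 3) K} (hord : (s : ℕ∞) ≤ ordZero H) :
    pts s f u v (chartTransform s u H) = (pts s f u v H).image psi := by
  classical
  have hsupp : ∀ d ∈ H.support, s ≤ d.degree := fun d hd => le_degree_of_mem_support hord hd
  have hσ := fin3_exhaust hfu hfv huv
  ext x
  rw [mem_pts, Finset.mem_image]
  constructor
  · rintro ⟨D, hD, hDf, rfl⟩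
    rw [HauserPerlega2024.support_chartTransform s u hsupp, Finset.mem_image] at hD
    obtain ⟨d, hd, rfl⟩ := hD
    rw [PointBlowup.chartExponent_apply, if_neg hfu] at hDf
    exact ⟨pt s f u v d, pt_mem_pts hd hDf, (pt_chartExponent_fst hfu hfv huv hσ (hsupp d hd) hDf).symm⟩
  · rintro ⟨y, hy, rfl⟩
    obtain ⟨d, hd, hdf, rfl⟩ := mem_pts.mp hy
    refine ⟨chartExponent s u d, ?_, ?_, pt_chartExponent_fst hfu hfv huv hσ (hsupp d hd) hdf⟩
    · rw [HauserPerlega2024.support_chartTransform s u hsupp]; exact Finset.mem_image_of_mem _ hd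
    · rw [PointBlowup.chartExponent_apply, if_neg hfu]; exact hdf

end WallChart

end Summit.ResolutionOfSingularities.ResolutionOfSingularities.Theorems.WildDescent
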